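import Summits.Ventures.Crystal3D.Theorems.StickyWulffConstantTextureBuildCoverPieces
import Summits.Ventures.Crystal3D.Theorems.StickyWulffConstantTextureBuildBilayerFrames
import Summits.Ventures.Crystal3D.Theorems.StickyWulffConstantTextureBuildLawData
import HarnessLib

/-!
# TB-1 brick: THE CANONICAL WALL CELL — a `WallCell` / `PlacedCell` from two complete plates, with the FULL admissible law table
# (lane T, crux `TextureLiminfV5`, stmt-Ventures-23912; blueprint HOME/wulff-p2/g23/TB-COVER-BLUEPRINT-g23.md step S5(c))

HONEST FRAMING. Venture `Summits/Ventures/Crystal3D` (cell `crystal3d-full`), route `route-Ventures-StickyWulffConstant`, helper `--supports` the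
law-v5 crux `TextureLiminfV5` (stmt-Ventures-23912).  Definitions + bookkeeping (census-free, standard axioms).  No cover is built, no wall law is proved;
F-C1 not moved.

The constructor of `stub_TB_cover` (v8.24: `CoverH BarlowAdhesionTCap`) instantiates thousands of wall cells.  This file makes ONE, canonically:

* `cellLawM A₁ A₂`, `cellLawC A₁ A₂` — the FULL law table of a cell with (model-position) bilayer frames `A₁, A₂`: a shared axis and the charge
  `½·√(1 − ⟪m, e₃⟫²)` in the co-axial-distinct case, charge `13/25` otherwise, `0` for equal lattices; `cellLaw_admissible`
  (`BilayerChargeAdmissibleAt (13/25)`, the `WallCell.hadm` field) and **`cellLaw_full`** (the `Mesh₃.hlaw` clause: `¬CoAx → 13/25 ≤ c`,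
  `CoAx → distinct → ½√(1 − ⟪m,e₃⟫²) ≤ c`);
* **`WallCell.ofComplete`** — from two presented Hägg stackings, `0 < R₀ ≤ ρ`, `0 ≤ h`, and a `1`-separated model-position configuration `Y` in which BOTH
  PLATE SLABS ARE COMPLETE (every site of stacking 1 at heights `[−2R₀, −R₀]` within radius `ρ` is a ball, similarly stacking 2 at `[h+R₀, h+2R₀]`), the wall
  cell with `X := Y ∩ cyl`, plates = the two slabs, frames from `exists_bilayerFrames`, law table `cellLaw`; `WallCell.ofComplete_full` (its table is FULL,
  the `Mesh₃.hlaw` clause) and `WallCell.ofComplete_mem_X` (it holds every configuration ball of its cylinder, the `hfull` of `tilingRim_le_general`);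
* **`PlacedCell.ofComplete`** — the same cell PLACED by a rigid motion `p ↦ M p + t` into an actual configuration `X'` (model configuration = the pull-back).
-/

noncomputable section

open scoped BigOperators InnerProductSpace
open MeasureTheory

namespace Summit.Ventures.Crystal3D.Cruxes.TextureLiminf.TexShadow

open Summit.Ventures.Crystal3D Summit.Ventures.Crystal3D.Theorems
open Literature.MathematicalPhysics.StatisticalMechanics (IsHaggSeq)

/-! ## The full law table of a cell -/

section Law

variable (A₁ A₂ : ℤ → (E3 ≃ₗᵢ[ℝ] E3))

open scoped Classical in
/-- the cell's wall AXIS: a shared axis of the two bilayer frames when they are co-axial, `0` otherwise. -/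
def cellLawM (i j : ℤ) : E3 :=
  if h : CoAx (A₁ i) (A₂ j) then Classical.choose h else 0

open scoped Classical in
/-- the cell's CHARGE: `0` for equal lattices, `½·√(1 − ⟪m, e₃⟫²)` for co-axial distinct lattices (`m` the chosen shared axis), `13/25` otherwise. -/
def cellLawC (i j : ℤ) : ℝ :=
  if A₁ i '' fccRef = A₂ j '' fccRef then 0
  else if CoAx (A₁ i) (A₂ j) then 1 / 2 * Real.sqrt (1 - ⟪cellLawM A₁ A₂ i j, e₃⟫_ℝ ^ 2) else 13 / 25

/-- In the co-axial case the cell axis is a shared axis. -/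
theorem sharedAxis_cellLawM {i j : ℤ} (h : CoAx (A₁ i) (A₂ j)) : SharedAxis (cellLawM A₁ A₂ i j) (A₁ i) (A₂ j) := by
  unfold cellLawM
  rw [dif_pos h]
  exact Classical.choose_spec h

/-- The co-axial charge is at most `½ ≤ 13/25`. -/
theorem half_sqrt_le (m : E3) : 1 / 2 * Real.sqrt (1 - ⟪m, e₃⟫_ℝ ^ 2) ≤ 13 / 25 := by
  have h : Real.sqrt (1 - ⟪m, e₃⟫_ℝ ^ 2) ≤ 1 :=
    calc Real.sqrt (1 - ⟪m, e₃⟫_ℝ ^ 2) ≤ Real.sqrt 1 := Real.sqrt_le_sqrt (by nlinarith [sq_nonneg ⟪m, e₃⟫_ℝ])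
      _ = 1 := Real.sqrt_one
  linarith

/-- `cellLawC ≥ 0`. -/
theorem cellLawC_nonneg (i j : ℤ) : 0 ≤ cellLawC A₁ A₂ i j := by
  unfold cellLawC
  split_ifs
  · exact le_rfl
  · exact mul_nonneg (by norm_num) (Real.sqrt_nonneg _)
  · norm_num

/-- `cellLawC ≤ 13/25`. -/
theorem cellLawC_le (i j : ℤ) : cellLawC A₁ A₂ i j ≤ 13 / 25 := by
  unfold cellLawC
  split_ifs
  · norm_num
  · exact half_sqrt_le _
  · exact le_rfl

/-- **The cell's law table is admissible at cap `13/25`** (the `WallCell.hadm` field). -/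
theorem cellLaw_admissible : BilayerChargeAdmissibleAt (13 / 25) A₁ A₂ (cellLawC A₁ A₂) (cellLawM A₁ A₂) := by
  refine ⟨cellLawC_nonneg A₁ A₂, cellLawC_le A₁ A₂, ?_, ?_⟩
  · intro i j hco hne
    refine ⟨sharedAxis_cellLawM A₁ A₂ hco, ?_⟩
    unfold cellLawC
    rw [if_neg hne, if_pos hco]
  · intro i j heq
    unfold cellLawC
    rw [if_pos heq]

/-- **The cell's law table is FULL** (the `Mesh₃.hlaw` clause): it charges exactly what the law allows. -/
theorem cellLaw_full (i j : ℤ) :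
    (¬ CoAx (A₁ i) (A₂ j) → (13 / 25 : ℝ) ≤ cellLawC A₁ A₂ i j) ∧
    (CoAx (A₁ i) (A₂ j) → A₁ i '' fccRef ≠ A₂ j '' fccRef →
      1 / 2 * Real.sqrt (1 - ⟪cellLawM A₁ A₂ i j, e₃⟫_ℝ ^ 2) ≤ cellLawC A₁ A₂ i j) := by
  constructor
  · intro hnco
    have hne : A₁ i '' fccRef ≠ A₂ j '' fccRef := fun heq => hnco (coAx_of_image_eq heq)
    unfold cellLawC
    rw [if_neg hne, if_neg hnco]
  · intro hco hne
    unfold cellLawC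
    rw [if_neg hne, if_pos hco]

end Law

/-! ## The canonical wall cell from two complete plates -/

section OfComplete

variable (C R₀ : ℝ) {σ₁ σ₂ : ℤ → ℤ} (hσ₁ : IsHaggSeq σ₁) (hσ₂ : IsHaggSeq σ₂) (L₁ L₂ : E3 ≃ₗᵢ[ℝ] E3) (s₁ s₂ : E3)
  {h ρ : ℝ} (hR₀ : 0 < R₀) (hh : 0 ≤ h) (hρ : R₀ ≤ ρ)
  (Y : Finset E3) (hY : ∀ p ∈ Y, ∀ q ∈ Y, p ≠ q → 1 ≤ dist p q)
  (hc₁ : ∀ p ∈ stacking L₁ s₁ σ₁, -(2 * R₀) ≤ p 2 → p 2 ≤ -R₀ → p 0 ^ 2 + p 1 ^ 2 ≤ ρ ^ 2 → p ∈ Y)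
  (hc₂ : ∀ p ∈ stacking L₂ s₂ σ₂, h + R₀ ≤ p 2 → p 2 ≤ h + 2 * R₀ → p 0 ^ 2 + p 1 ^ 2 ≤ ρ ^ 2 → p ∈ Y)

open scoped Classical in
/-- **THE CANONICAL WALL CELL** in model position: balls = the configuration's balls in the clamped cylinder, plates = the two complete slabs, frames =
`exists_bilayerFrames`, law table = `cellLaw`. -/
def WallCell.ofComplete : WallCell C R₀ where
  σ₁ := σ₁
  σ₂ := σ₂
  hσ₁ := hσ₁
  hσ₂ := hσ₂
  L₁ := L₁
  L₂ := L₂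
  s₁ := s₁
  s₂ := s₂
  A₁ := Classical.choose (exists_bilayerFrames hσ₁ L₁ s₁)
  A₂ := Classical.choose (exists_bilayerFrames hσ₂ L₂ s₂)
  hA₁ := Classical.choose_spec (exists_bilayerFrames hσ₁ L₁ s₁)
  hA₂ := Classical.choose_spec (exists_bilayerFrames hσ₂ L₂ s₂)
  c := cellLawC (Classical.choose (exists_bilayerFrames hσ₁ L₁ s₁)) (Classical.choose (exists_bilayerFrames hσ₂ L₂ s₂))
  m := cellLawM (Classical.choose (exists_bilayerFrames hσ₁ L₁ s₁)) (Classical.choose (exists_bilayerFrames hσ₂ L₂ s₂))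
  hadm := cellLaw_admissible _ _
  h := h
  ρ := ρ
  hh := hh
  hρ := hρ
  X := Y.filter fun p => p ∈ cyl R₀ h ρ
  P₁ := Y.filter fun p => p ∈ stacking L₁ s₁ σ₁ ∧ -(2 * R₀) ≤ p 2 ∧ p 2 ≤ -R₀ ∧ p 0 ^ 2 + p 1 ^ 2 ≤ ρ ^ 2
  P₂ := Y.filter fun p => p ∈ stacking L₂ s₂ σ₂ ∧ h + R₀ ≤ p 2 ∧ p 2 ≤ h + 2 * R₀ ∧ p 0 ^ 2 + p 1 ^ 2 ≤ ρ ^ 2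
  hX := fun p hp q hq hpq => hY p (Finset.mem_filter.1 hp).1 q (Finset.mem_filter.1 hq).1 hpq
  hP₁ := by
    intro p hp
    obtain ⟨hpY, -, h1, h2, h3⟩ := Finset.mem_filter.1 hp
    exact Finset.mem_filter.2 ⟨hpY, ⟨h1, by linarith, h3⟩⟩
  hP₂ := by
    intro p hp
    obtain ⟨hpY, -, h1, h2, h3⟩ := Finset.mem_filter.1 hp
    refine Finset.mem_sdiff.2 ⟨Finset.mem_filter.2 ⟨hpY, ⟨by linarith, h2, h3⟩⟩, fun hp1 => ?_⟩
    obtain ⟨-, -, -, h2', -⟩ := Finset.mem_filter.1 hp1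
    linarith
  hcyl := fun p hp => (Finset.mem_filter.1 hp).2
  hP₁iff := by
    intro p
    constructor
    · intro hp
      exact (Finset.mem_filter.1 hp).2
    · rintro ⟨hS, h1, h2, h3⟩
      exact Finset.mem_filter.2 ⟨hc₁ p hS h1 h2 h3, hS, h1, h2, h3⟩
  hP₂iff := by
    intro p
    constructor
    · intro hp
      exact (Finset.mem_filter.1 hp).2
    · rintro ⟨hS, h1, h2, h3⟩
      exact Finset.mem_filter.2 ⟨hc₂ p hS h1 h2 h3, hS, h1, h2, h3⟩

/-- The canonical cell's law table is FULL (ready for `Mesh₃.hlaw`). -/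
theorem WallCell.ofComplete_full (i j : ℤ) :
    (¬ CoAx ((WallCell.ofComplete C R₀ hσ₁ hσ₂ L₁ L₂ s₁ s₂ hR₀ hh hρ Y hY hc₁ hc₂).A₁ i)
        ((WallCell.ofComplete C R₀ hσ₁ hσ₂ L₁ L₂ s₁ s₂ hR₀ hh hρ Y hY hc₁ hc₂).A₂ j) →
      (13 / 25 : ℝ) ≤ (WallCell.ofComplete C R₀ hσ₁ hσ₂ L₁ L₂ s₁ s₂ hR₀ hh hρ Y hY hc₁ hc₂).c i j) ∧
    (CoAx ((WallCell.ofComplete C R₀ hσ₁ hσ₂ L₁ L₂ s₁ s₂ hR₀ hh hρ Y hY hc₁ hc₂).A₁ i)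
        ((WallCell.ofComplete C R₀ hσ₁ hσ₂ L₁ L₂ s₁ s₂ hR₀ hh hρ Y hY hc₁ hc₂).A₂ j) →
      (WallCell.ofComplete C R₀ hσ₁ hσ₂ L₁ L₂ s₁ s₂ hR₀ hh hρ Y hY hc₁ hc₂).A₁ i '' fccRef ≠
        (WallCell.ofComplete C R₀ hσ₁ hσ₂ L₁ L₂ s₁ s₂ hR₀ hh hρ Y hY hc₁ hc₂).A₂ j '' fccRef →
      1 / 2 * Real.sqrt (1 - ⟪(WallCell.ofComplete C R₀ hσ₁ hσ₂ L₁ L₂ s₁ s₂ hR₀ hh hρ Y hY hc₁ hc₂).m i j, e₃⟫_ℝ ^ 2) ≤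
        (WallCell.ofComplete C R₀ hσ₁ hσ₂ L₁ L₂ s₁ s₂ hR₀ hh hρ Y hY hc₁ hc₂).c i j) :=
  cellLaw_full _ _ i j

open scoped Classical in
/-- The canonical cell holds ALL configuration balls of its cylinder (the `hfull` hypothesis of `PlacedCell.tilingRim_le_general`). -/
theorem WallCell.ofComplete_mem_X {p : E3} (hp : p ∈ Y) (hpc : p ∈ cyl R₀ h ρ) :
    p ∈ (WallCell.ofComplete C R₀ hσ₁ hσ₂ L₁ L₂ s₁ s₂ hR₀ hh hρ Y hY hc₁ hc₂).X :=
  Finset.mem_filter.2 ⟨hp, hpc⟩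

end OfComplete

/-! ## The canonical placed cell -/

section Placed

variable (C R₀ : ℝ) {σ₁ σ₂ : ℤ → ℤ} (hσ₁ : IsHaggSeq σ₁) (hσ₂ : IsHaggSeq σ₂) (L₁ L₂ : E3 ≃ₗᵢ[ℝ] E3) (s₁ s₂ : E3)
  {h ρ : ℝ} (hR₀ : 0 < R₀) (hh : 0 ≤ h) (hρ : R₀ ≤ ρ) (X' : Finset E3)
  (M : E3 ≃ₗᵢ[ℝ] E3) (t : E3)

open scoped Classical in
/-- the configuration PULLED BACK to model position by the motion `p ↦ M p + t` -/
def pullback : Finset E3 := X'.image fun p => M.symm (p - t)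

/-- The pulled-back configuration is `1`-separated. -/
theorem pullback_sep (hX' : ∀ p ∈ X', ∀ q ∈ X', p ≠ q → 1 ≤ dist p q) :
    ∀ p ∈ pullback X' M t, ∀ q ∈ pullback X' M t, p ≠ q → 1 ≤ dist p q := by
  classical
  intro p hp q hq hpq
  unfold pullback at hp hq
  obtain ⟨a, ha, rfl⟩ := Finset.mem_image.1 hp
  obtain ⟨b, hb, rfl⟩ := Finset.mem_image.1 hq
  have hab : a ≠ b := fun hab => hpq (by rw [hab])
  have := hX' a ha b hb hab
  rwa [← dist_sub_right a b t, ← M.symm.dist_map] at this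

/-- Pushing the pulled-back configuration forward recovers it. -/
theorem image_rigid_pullback : (pullback X' M t).image (rigid M t) = X' := by
  classical
  unfold pullback
  rw [Finset.image_image]
  have : (rigid M t ∘ fun p => M.symm (p - t)) = id := by
    funext p; exact rigid_symm_apply _ _ _
  rw [this, Finset.image_id]

variable (hc₁ : ∀ p ∈ stacking L₁ s₁ σ₁, -(2 * R₀) ≤ p 2 → p 2 ≤ -R₀ → p 0 ^ 2 + p 1 ^ 2 ≤ ρ ^ 2 → p ∈ pullback X' M t)
  (hc₂ : ∀ p ∈ stacking L₂ s₂ σ₂, h + R₀ ≤ p 2 → p 2 ≤ h + 2 * R₀ → p 0 ^ 2 + p 1 ^ 2 ≤ ρ ^ 2 → p ∈ pullback X' M t)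

open scoped Classical in
/-- **THE CANONICAL PLACED CELL**: the canonical cell of the pulled-back configuration, placed by `p ↦ M p + t`. -/
def PlacedCell.ofComplete (hX' : ∀ p ∈ X', ∀ q ∈ X', p ≠ q → 1 ≤ dist p q) : PlacedCell C R₀ X' where
  toWallCell := WallCell.ofComplete C R₀ hσ₁ hσ₂ L₁ L₂ s₁ s₂ hR₀ hh hρ (pullback X' M t) (pullback_sep X' M t hX') hc₁ hc₂
  M := M
  t := t
  hX' := by
    intro q hq
    have hsub : (WallCell.ofComplete C R₀ hσ₁ hσ₂ L₁ L₂ s₁ s₂ hR₀ hh hρ (pullback X' M t) (pullback_sep X' M t hX') hc₁ hc₂).X ⊆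
        pullback X' M t := Finset.filter_subset _ _
    rw [← image_rigid_pullback X' M t]
    exact Finset.image_subset_image hsub hq

end Placed

end Summit.Ventures.Crystal3D.Cruxes.TextureLiminf.TexShadow

end
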